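import Summits.RiemannHypothesis.RiemannHypothesis.Theorems.PfPersistenceDefectiveTransportShape
import Summits.RiemannHypothesis.RiemannHypothesis.Theorems.GroundBartaPolarPerronFrobeniusThetaQuasimode
import HarnessLib

/-!
# PF persistence campaign (cell `pub-rhpf`, leaf G1.22 TRANSPORT-1, gen 8): the transport kernel of
record, part 8b — RH-FREE exclusions on the shape of the Weil bottom

Honest framing (verbatim, applies to every line): mechanism/rigidity campaign; no RH claims.

Part 8 (`PfPersistenceDefectiveTransportShape`) placed the shape readings of
`ε = Literature.NumberTheory.LFunctions.weilGroundEnergy` on the floor-rate ladder: eventual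
convexity in `a` (or in the archimedean clock) is RH-strength, clock-`κ` convexity is the strip
`κ/2`, eventual concavity in any increasing clock refutes RH.  This part records what is EXCLUDED
WITHOUT ANY HYPOTHESIS, by playing the elementary secant inequalities against the two unconditional
envelopes of the tree — the trivial floor `−C e^{κ' a} ≤ ε a` for `κ' > 1`
(`weilGroundEnergy_exp_lower_of_one_lt`) and the super-exponential ceilings
`ε a ≤ C exp (−c e^{2a})` (`weilGroundEnergy_exp_exp_decay`),
`ε_ev a ≤ exp (−c e^{2a})` (`PolarPerronFrobenius.weilEvenGroundEnergy_le_exp_neg_mul_exp`):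

* `not_concaveOn_expClock_of_one_lt` — for `κ > 1` the bottom is concave against the clock
  `t = e^{κ a}` on NO half-line (a concave function with a strict drop sinks linearly in `t`, i.e.
  like `−c e^{κ a}`, through the trivial floor of rate `κ' ∈ (1, κ)`).  UNCONDITIONAL;
* `not_logConvexOn` — the bottom is not eventually LOG-CONVEX where it is positive (a log-convex
  positive function has a floor `e^{−A − B a}`, incompatible with the `exp (−c e^{2a})` ceiling);
  UNCONDITIONAL (the positivity binder is the only hypothesis; under RH it holds, so RH ⟹ `log ε` is
  not eventually convex — the DATA of TRANSPORT-TABLES L5 showed log-concavity);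
* `not_riemannHypothesis_of_concaveOn_even` — eventual concavity in `a` of the EVEN-sector bottom
  `ε_ev` (the PF object of the cell) refutes RH: under RH `ε_ev ≥ ε ≥ 0`, a concave function
  bounded below never drops, with antitonicity it is constant `L ≥ 0`; `L > 0` contradicts the
  theta-quasimode ceiling and `L = 0` forces `ε ≡ 0` on a segment, contradicting strict decrease.
  RH-free implication.

No reach number is produced; nothing here is a step toward RH — these are typed NEGATIVE shape facts
that retire the corresponding transport candidates (TRANSPORT.md §17).

References: E. Bombieri, Rend. Mat. Acc. Lincei (9) 11 (2000) §4; A. Connes, C. Consani,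
H. Moscovici, arXiv:2511.22755 §3; secant inequalities [folklore].
-/

noncomputable section

set_option linter.dupNamespace false

namespace Summit.RiemannHypothesis.RiemannHypothesis.Theorems.PfPersistenceDefectiveTransport

open Set
open _root_.Literature.NumberTheory.LFunctions
open _root_.Summit.RiemannHypothesis.RiemannHypothesis.Theorems.WeilWindowFlowGronwallLeakage
  (weilGroundEnergy_strictAntiOn)
open _root_.Summit.RiemannHypothesis.RiemannHypothesis.Theorems.PolarPerronFrobenius
  (weilEvenGroundEnergy_le_exp_neg_mul_exp)

/-! ## §1 Super-clock concavity is impossible (κ > 1), unconditionally -/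

/-- **For `κ > 1` the Weil bottom is concave against the clock `t = e^{κ a}` on no half-line.**
If `t ↦ ε (log t / κ)` were concave on `[t₀, ∞)` (any `t₀`; the argument runs on
`[max t₀ 2, ∞)`), the strict decrease of `ε` would give a secant of negative slope `−c` and the
ceiling `ε a ≤ E − c e^{κ a}`; but `−C e^{κ' a} ≤ ε a` for `κ' = (1 + κ)/2 ∈ (1, κ)` (trivial
floor), and `c e^{κ a} − C e^{κ' a} → ∞`.  UNCONDITIONAL,
RH-free; no RH claim. [folklore] -/
theorem not_concaveOn_expClock_of_one_lt {κ : ℝ} (hκ : 1 < κ) (t₀ : ℝ) :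
    ¬ ConcaveOn ℝ (Ici t₀) (fun t : ℝ => weilGroundEnergy (Real.log t / κ)) := by
  intro hconc
  have hκ0 : 0 < κ := by linarith
  set g : ℝ → ℝ := fun t : ℝ => weilGroundEnergy (Real.log t / κ) with hg
  set t₁ : ℝ := max t₀ 2 with ht₁
  have ht₁2 : 2 ≤ t₁ := le_max_right _ _
  have hconc' : ConcaveOn ℝ (Ici t₁) g :=
    hconc.subset (Ici_subset_Ici.2 (le_max_left _ _)) (convex_Ici _)
  -- strict drop between `t₁` and `t₁ + 1`
  have hlog1 : 0 < Real.log t₁ / κ := div_pos (Real.log_pos (by linarith)) hκ0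
  have hlog2 : Real.log t₁ / κ < Real.log (t₁ + 1) / κ :=
    div_lt_div_of_pos_right (Real.log_lt_log (by linarith) (by linarith)) hκ0
  have hdrop : g (t₁ + 1) < g t₁ :=
    weilGroundEnergy_strictAntiOn (mem_Ioi.2 hlog1) (mem_Ioi.2 (hlog1.trans hlog2)) hlog2
  set c : ℝ := (g t₁ - g (t₁ + 1)) / (t₁ + 1 - t₁) with hc
  have hc1 : c = g t₁ - g (t₁ + 1) := by rw [hc]; simp
  have hcpos : 0 < c := by rw [hc1]; linarith
  -- the two envelopes
  set κ' : ℝ := (1 + κ) / 2 with hκ'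
  have hκ'1 : 1 < κ' := by rw [hκ']; linarith
  have hκκ' : 0 < κ - κ' := by rw [hκ']; linarith
  obtain ⟨C, hC⟩ := weilGroundEnergy_exp_lower_of_one_lt hκ'1
  set E : ℝ := g (t₁ + 1) + c * (t₁ + 1) with hE
  -- a large `a`
  set a : ℝ := (max C 0 + max E 0 + 1) / (c * (κ - κ')) + Real.log (t₁ + 1) / κ + 1 with ha
  have hq0 : 0 ≤ (max C 0 + max E 0 + 1) / (c * (κ - κ')) := by positivity
  have hl0 : 0 ≤ Real.log (t₁ + 1) / κ := div_nonneg (Real.log_nonneg (by linarith)) hκ0.le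
  have ha0 : 0 < a := by rw [ha]; linarith
  have haq : (max C 0 + max E 0 + 1) / (c * (κ - κ')) ≤ a := by rw [ha]; linarith
  have hal : Real.log (t₁ + 1) / κ ≤ a := by rw [ha]; linarith
  -- `t = e^{κ a} ≥ t₁ + 1` and `g t = ε a`
  have hκa : Real.log (t₁ + 1) ≤ κ * a := by
    have := (div_le_iff₀ hκ0).1 hal
    linarith [mul_comm a κ]
  have ht : t₁ + 1 ≤ Real.exp (κ * a) := by
    calc t₁ + 1 = Real.exp (Real.log (t₁ + 1)) := (Real.exp_log (by linarith)).symm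
      _ ≤ Real.exp (κ * a) := Real.exp_le_exp.2 hκa
  have hga : g (Real.exp (κ * a)) = weilGroundEnergy a := by
    simp only [hg, Real.log_exp, mul_div_cancel_left₀ a hκ0.ne']
  -- ceiling and floor at `a`
  have hceil := le_line_of_concaveOn hconc' (le_refl t₁) (by linarith : t₁ < t₁ + 1) ht
  rw [← hc, hga] at hceil
  have hfloor := hC a ha0
  -- `e^{κ a} ≥ (1 + (κ - κ') a) e^{κ' a}`
  have hsplit : Real.exp (κ * a) = Real.exp ((κ - κ') * a) * Real.exp (κ' * a) := by
    rw [← Real.exp_add]; ring_nf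
  have hlin : (κ - κ') * a + 1 ≤ Real.exp ((κ - κ') * a) := Real.add_one_le_exp _
  have he'1 : 1 ≤ Real.exp (κ' * a) := Real.one_le_exp (by positivity)
  have he'0 : 0 ≤ Real.exp (κ' * a) := (Real.exp_pos _).le
  -- bracket `c (1 + (κ - κ') a) - C ≥ max E 0 + 1`
  have hbr : max E 0 + 1 + c ≤ c * ((κ - κ') * a + 1) - C := by
    have h1 : max C 0 + max E 0 + 1 ≤ c * (κ - κ') * a := by
      have := (div_le_iff₀ (by positivity : 0 < c * (κ - κ'))).1 haq
      linarith [mul_comm a (c * (κ - κ'))]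
    have h2 : C ≤ max C 0 := le_max_left _ _
    nlinarith
  -- `c e^{κ a} - C e^{κ' a} ≥ (c((κ-κ')a+1) - C) e^{κ' a} ≥ c((κ-κ')a+1) - C > E`
  have hkey : E < c * Real.exp (κ * a) - C * Real.exp (κ' * a) := by
    have h1 : c * ((κ - κ') * a + 1) * Real.exp (κ' * a) ≤ c * Real.exp (κ * a) := by
      rw [hsplit, ← mul_assoc]
      exact mul_le_mul_of_nonneg_right (mul_le_mul_of_nonneg_left hlin hcpos.le) he'0
    have h2 : (c * ((κ - κ') * a + 1) - C) * 1 ≤ (c * ((κ - κ') * a + 1) - C) * Real.exp (κ' * a) :=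
      mul_le_mul_of_nonneg_left he'1 (by linarith [le_max_right E 0])
    have h3 : E ≤ max E 0 := le_max_left _ _
    nlinarith
  -- but ceiling & floor give `c e^{κ a} - C e^{κ' a} ≤ E`
  have : c * Real.exp (κ * a) - C * Real.exp (κ' * a) ≤ E := by
    rw [hE]; nlinarith
  linarith

/-! ## §2 No eventual log-convexity, unconditionally -/

/-- **The Weil bottom is not eventually log-convex (where positive).**  If `ε > 0` on `[b, ∞)`
(`b > 0`) and `a ↦ log (ε a)` were convex there, the secant floor `log ε a ≥ −(A + B a)` (part 8,
`linearFloor_of_convexOn`) would give `ε a ≥ e^{−A − B a}`, against the super-exponential ceiling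
`ε a ≤ C exp (−c e^{2a})` (`weilGroundEnergy_exp_exp_decay`) and `e^{2a} ≥ (1 + a)^2`.
UNCONDITIONAL apart from the displayed positivity binder (which RH implies); RH-free; no RH claim.
[folklore] -/
theorem not_logConvexOn {b : ℝ} (hb : 0 < b) (hpos : ∀ a : ℝ, b ≤ a → 0 < weilGroundEnergy a) :
    ¬ ConvexOn ℝ (Ici b) (fun a : ℝ => Real.log (weilGroundEnergy a)) := by
  intro hconv
  set h : ℝ → ℝ := fun a : ℝ => Real.log (weilGroundEnergy a) with hh
  obtain ⟨c, hc, C, hC⟩ := weilGroundEnergy_exp_exp_decay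
  set A : ℝ := -h (b + 1) with hA
  set B : ℝ := max (h b - h (b + 1)) 0 with hB
  have hB0 : 0 ≤ B := le_max_right _ _
  have hfloor : ∀ a : ℝ, b + 1 ≤ a → -(A + B * a) ≤ h a := by
    intro a ha
    have := linearFloor_of_convexOn (f := h) (by linarith) hconv a ha
    rw [← hB] at this
    simpa [hA] using this
  -- positivity of `C` (else `ε ≤ 0` at `a = max (b+1) 1`)
  set a₁ : ℝ := max (b + 1) 1 with ha₁
  have ha₁b : b + 1 ≤ a₁ := le_max_left _ _
  have ha₁1 : 1 ≤ a₁ := le_max_right _ _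
  have hCpos : 0 < C := by
    have h1 := hC a₁ ha₁1
    have h2 := hpos a₁ (by linarith)
    have h3 : 0 < Real.exp (-c * Real.exp (2 * a₁)) := Real.exp_pos _
    by_contra hle
    rw [not_lt] at hle
    nlinarith
  -- the contradiction at a large `a`: `c e^{2a} ≤ log C + A + B a`
  set K : ℝ := Real.log C + A with hK
  set a : ℝ := a₁ + (|B| + |K| + 1) / c with ha
  have hq : 0 ≤ (|B| + |K| + 1) / c := by positivity
  have hab : b + 1 ≤ a := by rw [ha]; linarith
  have ha1 : 1 ≤ a := by rw [ha]; linarith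
  have ha0 : 0 ≤ a := by linarith
  have hεa : 0 < weilGroundEnergy a := hpos a (by linarith)
  -- log of the ceiling: `h a ≤ log C - c e^{2a}`
  have hup : h a ≤ Real.log C + -c * Real.exp (2 * a) := by
    have h1 := hC a ha1
    have h2 : Real.log (weilGroundEnergy a) ≤ Real.log (C * Real.exp (-c * Real.exp (2 * a))) :=
      Real.log_le_log hεa h1
    rw [Real.log_mul hCpos.ne' (Real.exp_pos _).ne', Real.log_exp] at h2
    simpa [hh] using h2
  have hlow := hfloor a hab
  -- `e^{2a} ≥ (1 + a)^2 ≥ a^2 + 2a + 1`, and `c a^2 ≥ (|B| + |K| + 1) a`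
  have hexp : (a + 1) ^ 2 ≤ Real.exp (2 * a) := by
    have h1 : a + 1 ≤ Real.exp a := Real.add_one_le_exp a
    have h2 : Real.exp (2 * a) = Real.exp a ^ 2 := by rw [← Real.exp_nat_mul]; norm_num
    rw [h2]
    exact pow_le_pow_left₀ (by linarith) h1 2
  have hca : |B| + |K| + 1 ≤ c * (a - a₁) := by
    have : a - a₁ = (|B| + |K| + 1) / c := by rw [ha]; ring
    rw [this, mul_div_cancel₀ _ hc.ne']
  have hBa : B * a ≤ |B| * a := mul_le_mul_of_nonneg_right (le_abs_self B) ha0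
  have hKa : K ≤ |K| := le_abs_self K
  -- assemble: c e^{2a} ≤ K + B a (from hup, hlow), but c e^{2a} ≥ c (a+1)^2 > K + B a
  have h1 : c * Real.exp (2 * a) ≤ K + B * a := by rw [hK]; linarith
  have h2 : c * (a + 1) ^ 2 ≤ c * Real.exp (2 * a) := mul_le_mul_of_nonneg_left hexp hc.le
  have ha₁0 : 0 ≤ a₁ := by linarith
  nlinarith [mul_nonneg hc.le ha₁0, mul_nonneg (abs_nonneg B) ha0, abs_nonneg K]

/-! ## §3 Eventual concavity of the even-sector (PF) bottom refutes RH -/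

/-- **Eventual concavity in `a` of the even-sector bottom `ε_ev` refutes RH.**  Under RH
`0 ≤ ε ≤ ε_ev` on `(0, ∞)`; a concave function on `[b, ∞)` bounded below never drops strictly
(secant ceiling, part 8 `le_line_of_concaveOn`), and `ε_ev` is antitone, so `ε_ev ≡ L ≥ 0` on
`[b, ∞)`; `L > 0` contradicts the theta-quasimode ceiling `ε_ev a ≤ exp (−e^{2a})`
(`weilEvenGroundEnergy_le_exp_neg_mul_exp`), and `L = 0` gives `ε = 0` at two points of `(0, ∞)`,
contradicting strict decrease (`weilGroundEnergy_strictAntiOn`).  RH-free implication; the shape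
hypothesis is NOT claimed; no RH claim. [folklore] -/
theorem not_riemannHypothesis_of_concaveOn_even {b : ℝ} (hb : 0 < b)
    (hconc : ConcaveOn ℝ (Ici b) weilEvenGroundEnergy) : ¬ _root_.RiemannHypothesis := by
  intro hRH
  have hnn : ∀ a : ℝ, 0 < a → 0 ≤ weilEvenGroundEnergy a := fun a ha ↦
    (weilGroundEnergy_nonneg_of_riemannHypothesis hRH ha).trans
      (weilGroundEnergy_le_weilEvenGroundEnergy a)
  -- no strict drop on `[b, ∞)`
  have hflat : ∀ x y : ℝ, b ≤ x → x < y → weilEvenGroundEnergy x ≤ weilEvenGroundEnergy y := by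
    intro x y hx hxy
    by_contra hlt
    rw [not_le] at hlt
    set c : ℝ := (weilEvenGroundEnergy x - weilEvenGroundEnergy y) / (y - x) with hc
    have hcpos : 0 < c := div_pos (by linarith) (by linarith)
    have hy0 : 0 ≤ weilEvenGroundEnergy y := hnn y (by linarith)
    set t : ℝ := y + (weilEvenGroundEnergy y / c + 1) with ht
    have hq : 0 ≤ weilEvenGroundEnergy y / c := div_nonneg hy0 hcpos.le
    have hyt : y ≤ t := by rw [ht]; linarith
    have hceil := le_line_of_concaveOn hconc hx hxy hyt
    rw [← hc] at hceil
    have ht0 : 0 ≤ weilEvenGroundEnergy t := hnn t (by linarith)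
    have e : (t - y) * c = weilEvenGroundEnergy y + c := by
      rw [ht]; field_simp; ring
    nlinarith
  -- constant value `L = ε_ev (b + 1)` beyond `b + 1`
  have hconst : ∀ a : ℝ, b + 1 ≤ a → weilEvenGroundEnergy a = weilEvenGroundEnergy (b + 1) := by
    intro a ha
    rcases ha.eq_or_lt with h | h
    · rw [h]
    · exact le_antisymm (weilEvenGroundEnergy_antitone (by linarith) h.le)
        (hflat (b + 1) a (by linarith) h)
  set L : ℝ := weilEvenGroundEnergy (b + 1) with hL
  have hL0 : 0 ≤ L := hnn (b + 1) (by linarith)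
  rcases hL0.eq_or_lt with hL00 | hLpos
  · -- `L = 0`: `ε (b+1) = ε (b+2) = 0`, contradicting strict decrease
    have h1 : weilGroundEnergy (b + 1) = 0 := le_antisymm
      ((weilGroundEnergy_le_weilEvenGroundEnergy (b + 1)).trans hL00.symm.le)
      (weilGroundEnergy_nonneg_of_riemannHypothesis hRH (by linarith))
    have h2 : weilGroundEnergy (b + 2) = 0 := le_antisymm
      ((weilGroundEnergy_le_weilEvenGroundEnergy (b + 2)).trans
        (by rw [hconst (b + 2) (by linarith)]; exact hL00.symm.le))
      (weilGroundEnergy_nonneg_of_riemannHypothesis hRH (by linarith))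
    have h3 : weilGroundEnergy (b + 2) < weilGroundEnergy (b + 1) :=
      weilGroundEnergy_strictAntiOn (mem_Ioi.2 (by linarith : 0 < b + 1))
        (mem_Ioi.2 (by linarith : 0 < b + 2)) (by linarith)
    linarith
  · -- `L > 0`: contradicts `ε_ev a ≤ exp (-e^{2a})` at a large `a`
    obtain ⟨a₀, ha₀⟩ := weilEvenGroundEnergy_le_exp_neg_mul_exp (c := 1)
      (by linarith [Real.pi_gt_three])
    set a : ℝ := max a₀ (max (b + 1) (|Real.log L| + 1)) with ha
    have ha1 : a₀ ≤ a := le_max_left _ _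
    have ha2 : b + 1 ≤ a := (le_max_left _ _).trans (le_max_right _ _)
    have ha3 : |Real.log L| + 1 ≤ a := (le_max_right _ _).trans (le_max_right _ _)
    have h1 : weilEvenGroundEnergy a ≤ Real.exp (-(1 * Real.exp (2 * a))) := ha₀ a ha1
    rw [hconst a ha2] at h1
    -- `exp (-e^{2a}) < L` since `e^{2a} > -log L`
    have h2 : -(1 * Real.exp (2 * a)) < Real.log L := by
      have h3 : 2 * a + 1 ≤ Real.exp (2 * a) := Real.add_one_le_exp _
      have h4 : -Real.log L ≤ |Real.log L| := neg_le_abs _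
      linarith
    have h5 : Real.exp (-(1 * Real.exp (2 * a))) < L := by
      calc Real.exp (-(1 * Real.exp (2 * a))) < Real.exp (Real.log L) := Real.exp_lt_exp.2 h2
        _ = L := Real.exp_log hLpos
    linarith

end Summit.RiemannHypothesis.RiemannHypothesis.Theorems.PfPersistenceDefectiveTransport

end
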